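import Summits.QuantumFields.YangMills.Theorems.BalabanUVNodesN26BetaContFiniteRep
import Summits.QuantumFields.YangMills.Theorems.BalabanUVNodesN28AtBetaOfRecord

/-!
# DAG node N26 — «B4 closes WITH B3» AT THE β OF RECORD: endpoint existence (N25's END) AND N26's literal for every construction
# forward-generated by `betaOfMerged (betaMerged F 𝓝 ρ bV) β⁰ γ` (resp. `betaOfTerms F ℰ⁰ ℰ¹ ρ bV γ`), from row (D1)'s residue
# pinned ON THE ONE-LOOP OBJECT OF RECORD + the (D4) socket inputs; and the sockets for EVERY split (one-loop rigidity)

Cell `pub-ymgap`, YM-PLAN Track A (HUMAN RULING D-0062), seat `pub-ymgap-dag-n26-a` (gen 2; -a = KNIT-BY-NAME); fourth companion of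
`BalabanUVNodesN26BetaCont{Record,Merged,FiniteRep}`.  Gen 0's `BalabanUVNodesN26BetaCont` §2 stated at an ABSTRACT datum that N25
(endpoint existence) ∧ N26 ∧ N28(γ) come from ONE β-side package: a pinned split, row (D1)'s `Gaps.D1Residue.Residue`, rows (D4) ∧ B4's
`AtSlopeCont` at the one-loop slope, `0 < γ₀`.  Here the same is written AT THE β-FUNCTIONS OF RECORD with the (D4) half FED BY THE
SOCKET: the pinned split is the record's DEFINITIONAL split (`oneLoopSplit_betaOfMerged` ∕ `oneLoopSplit_betaOfTerms`), so row (D1)'s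
identification `hβ` reads ON THE NAMED ONE-LOOP OBJECT `β⁰` of the record (`β⁰_j = Σ_z T̄_j(z) z_μ z_ν`, the typed step kernels), and
`AtSlopeCont … γ₀ (stepBal N Lc)` is `atSlopeCont_betaOfMerged` ∕ `atSlopeCont_betaOfTerms` at the slope `s := stepBal N Lc`
(`Gaps.BetaContFromD4Chain.endpointExistence_of_residue_atSlopeCont` BY NAME; forward generation is the datum's structure field
`FiniteEpsData.fwd` at `D₀`).  §2: by dag-n28-a's ONE-LOOP RIGIDITY `N28AtBetaOfRecord.oneLoopSplit_unique` (the printed split is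
unique for ANY history family) the sockets hold for EVERY `Sβ : OneLoopSplit (β of record)` a NODE-O or (D1) road may carry — so gen 0's
datum-level theorems (`n26_of_atSlopeCont D Sβ`, `endpoint_and_n26_of_residue_atSlopeCont D Sβ …`) are fed by the sockets whatever `Sβ`
they quantify.

HONEST FRAMING.  Bookkeeping by name; NO estimate of Bałaban's series is proved; every hypothesis (the (D1) residue and pin, the socket
inputs `P0 ∕ hβ0 ∕ hP0 ∕ A1 ∕ hrep ∕ hleaves ∕ (C-pt)`, the side conditions, forward generation) is a located input of NODE O ∕ row (D1)
∕ Stage ₈ — instance 0∕1 on both rows; N25 and N26 are NOT discharged.  One finite four-torus programme at fixed ε per run; NOT ℝ⁴,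
NOT infinite volume, NOT OS, NOT a mass gap, NOT Clay.  Sources (context): [I] = Balaban1987RG1 Thm 2 p. 259 (first sentence),
(1.20)–(1.22) p. 264, (2.12)–(2.14) p. 268; [II] = Balaban1988RG2Cluster Lemma 3 (2.38) p. 20.
-/

noncomputable section

namespace Summit.QuantumFields.YangMills.Theorems.BalabanUVNodesN26WallEnd

open Literature.MathematicalPhysics.QuantumFieldTheory.Balaban1983to89
open Literature.MathematicalPhysics.QuantumFieldTheory.Balaban1983to89.FlowStep
open Literature.MathematicalPhysics.QuantumFieldTheory.Balaban1983to89.DagBinding (ForwardGenerated EndpointExistence)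
open Literature.MathematicalPhysics.QuantumFieldTheory.Balaban1983to89.T4Continuum (T4Family)
open Literature.MathematicalPhysics.QuantumFieldTheory.Balaban1983to89.Node00
open Literature.MathematicalPhysics.QuantumFieldTheory.Balaban1983to89.B13ScaleTransfer (Pt)
open Literature.MathematicalPhysics.QuantumFieldTheory.Balaban1983to89.Beta.RemainderChainLattice
open Literature.MathematicalPhysics.QuantumFieldTheory.Balaban1983to89.Beta.RemainderLimitTorus (LDom limKernel)
open Literature.MathematicalPhysics.QuantumFieldTheory.Balaban1983to89.Beta.RemainderDecay190
open Literature.MathematicalPhysics.QuantumFieldTheory.Balaban1983to89.Beta.RemainderLocalityHolo (PolLeavesTFac190H)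
open Literature.MathematicalPhysics.QuantumFieldTheory.Balaban1983to89.Beta.OneStepKernelFamily (TbalOf)
open Literature.MathematicalPhysics.QuantumFieldTheory.Balaban1983to89.Beta.OneStepResolventKernel (JetData)
open Summit.QuantumFields.BalabanUV.Gaps
open Summit.QuantumFields.BalabanUV.Gaps.BetaContFromD4Chain
open Summit.QuantumFields.YangMills.Theorems.BalabanUVNodesN26Record (atSlopeCont_betaOfTerms)
open Summit.QuantumFields.YangMills.Theorems.BalabanUVNodesN26Merged (atSlopeCont_betaOfMerged)
open Summit.QuantumFields.YangMills.BalabanUVNodes.N28AtBetaOfRecord (oneLoopSplit_unique)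
open Filter Topology

variable {𝔄 : Type*} [NormedRing 𝔄] [NormedAlgebra ℝ 𝔄]
variable {V : Type*} [NormedAddCommGroup V] [NormedSpace ℝ V] {ι : Type*} [Fintype ι]
variable (F : T4Family) (ρ : V →L[ℝ] 𝔄) (bV : Module.Basis ι ℝ V)
variable {γ γ₀ : ℝ} {M : ℕ} [NeZero M] {c : B13.Consts} {ℓ α₂ : ℝ} {q : Consts190}

/-! ## §1 Endpoint existence AND N26's literal at the β of record from (D1)'s residue + the (D4) socket inputs -/

section WallEnd

variable {Cn : B12.Construction} {Lc : ℕ} [NeZero Lc]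

/-- **N25's END ∧ N26 AT THE MERGED β OF RECORD** (design (β) of record): for every construction `Cn` forward-generated by
`betaOfMerged (betaMerged F 𝓝 ρ bV) β⁰ γ` (at `D₀`: the structure field `FiniteEpsData.fwd`), row (D1)'s identification of the NAMED
one-loop object with the typed step kernels `hβ : β⁰_j = Σ_z T̄_j(z) z_μ z_ν` and its residue `Gaps.D1Residue.Residue Lc Js N μ ν`, the
(D4) socket inputs of `atSlopeCont_betaOfMerged` on a box `0 < γ₀ ≤ γ` with smallness AT THE ONE-LOOP SLOPE `ε₁·K_rem,L ≤ stepBal N Lc`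
⟹ `EndpointExistence Cn` ([I] Thm 2, first sentence; `Gaps.BetaContFromD4Chain.endpointExistence_of_residue_atSlopeCont` BY NAME, (UP)
and (C) derived inside) AND `∃ γc > 0, BetaContH γc (β of record)` (γc := γ₀) — B4 closes WITH B3 from the same inputs.  Every binder a
located hypothesis; instance 0∕1 on rows (D1) and (D4); nothing discharged.
[cite: Balaban1987RG1, Thm 2 p.259 (first sentence) and (1.20)-(1.22) p.264; Balaban1988RG2Cluster, Lemma 3 (2.38) p.20] -/
theorem endpoint_and_n26_betaOfMerged (ℰ : TermFamily1 F 𝔄) (β0 : ℕ → ℝ)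
    (hgen : ForwardGenerated Cn (betaOfMerged (betaMerged F ℰ ρ bV) β0 γ))
    (Js : ℕ → JetData 3 Lc) {Nc : ℝ} {μ ν : Fin 4}
    (hβ : ∀ j, β0 j = B12Beta.secondMoment (TbalOf Lc Js j) μ ν) (h1 : D1Residue.Residue Lc Js Nc μ ν)
    (hγ₀ : 0 < γ₀) (hle : γ₀ ≤ γ) (P0 : ℕ → Pt 4 → ℝ)
    (hβ0 : ∀ k, β0 k = B12Beta.secondMoment (fun _ _ => P0 k) 0 1)
    (hP0 : ∀ k, ∃ C δ₁ : ℝ, 0 < δ₁ ∧ B12Sec2to5.Decay510 (P0 k) C δ₁)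
    (A1 : (k : ℕ) → (Fin (k + 1) → ℝ) → LDom 4 → Pt 4 → ℝ)
    (hrep : ∀ k (p : Fin (k + 1) → ℝ), p ∈ Box γ₀ k → ∀ z : Pt 4,
      polLimit F (k + 1) (fun K => ℰ k p K) ρ bV 0 1 z = P0 k z + limKernel (A1 k p) z)
    (hleaves : ∀ k (p : Fin (k + 1) → ℝ), p ∈ Box γ₀ k → PolLeavesTFac190H 4 M (A1 k p) c ℓ α₂ q)
    (hC : CondsL 4 c ℓ) (h22 : c.R22gen ℓ) (hq : q.Valid c.δ₀) (hs : SignsL c α₂ q.B₃)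
    (hsmall : c.ε₁ * remCoeffL 4 M c α₂ q.B₃ ≤ B12Normalization.stepBal Nc Lc)
    (hcont : ∀ k (z : Pt 4), ContinuousOn
      (fun p : Fin (k + 1) → ℝ => polLimit F (k + 1) (fun K => ℰ k p K) ρ bV 0 1 z) (Box γ₀ k)) :
    EndpointExistence Cn ∧ ∃ γc : ℝ, 0 < γc ∧ BetaContH γc (betaOfMerged (betaMerged F ℰ ρ bV) β0 γ) := by
  have hres : AtSlopeCont (oneLoopSplit_betaOfMerged (betaMerged F ℰ ρ bV) β0 γ) γ₀ (B12Normalization.stepBal Nc Lc) :=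
    atSlopeCont_betaOfMerged F ℰ ρ bV β0 hle P0 hβ0 hP0 A1 hrep hleaves hC h22 hq hs hsmall hcont
  exact ⟨endpointExistence_of_residue_atSlopeCont hgen (oneLoopSplit_betaOfMerged (betaMerged F ℰ ρ bV) β0 γ) Js
      (fun j => hβ j) h1 hγ₀ hres, γ₀, hγ₀, betaContH_of_atSlopeCont hres⟩

/-- **N25's END ∧ N26 AT THE TWO-FAMILY β OF RECORD** (`betaOfTerms F ℰ⁰ ℰ¹ ρ bV γ`; (D1)'s pin reads on `beta0OfTerms F ℰ⁰ ρ bV`, the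
coupling-free number of the record): the same composition with `atSlopeCont_betaOfTerms`.
[cite: Balaban1987RG1, Thm 2 p.259 (first sentence) and (1.20)-(1.22) p.264; Balaban1988RG2Cluster, Lemma 3 (2.38) p.20] -/
theorem endpoint_and_n26_betaOfTerms (ℰ0 : TermFamily0 F 𝔄) (ℰ1 : TermFamily1 F 𝔄)
    (hgen : ForwardGenerated Cn (betaOfTerms F ℰ0 ℰ1 ρ bV γ))
    (Js : ℕ → JetData 3 Lc) {Nc : ℝ} {μ ν : Fin 4}
    (hβ : ∀ j, beta0OfTerms F ℰ0 ρ bV j = B12Beta.secondMoment (TbalOf Lc Js j) μ ν)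
    (h1 : D1Residue.Residue Lc Js Nc μ ν) (hγ₀ : 0 < γ₀) (hle : γ₀ ≤ γ)
    (A1 : (k : ℕ) → (Fin (k + 1) → ℝ) → LDom 4 → Pt 4 → ℝ)
    (hrep : ∀ k (p : Fin (k + 1) → ℝ), p ∈ Box γ₀ k → ∀ z : Pt 4,
      polLimit F (k + 1) (fun K => ℰ1 k p K) ρ bV 0 1 z = limKernel (A1 k p) z)
    (hleaves : ∀ k (p : Fin (k + 1) → ℝ), p ∈ Box γ₀ k → PolLeavesTFac190H 4 M (A1 k p) c ℓ α₂ q)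
    (hC : CondsL 4 c ℓ) (h22 : c.R22gen ℓ) (hq : q.Valid c.δ₀) (hs : SignsL c α₂ q.B₃)
    (hsmall : c.ε₁ * remCoeffL 4 M c α₂ q.B₃ ≤ B12Normalization.stepBal Nc Lc)
    (hcont : ∀ k (z : Pt 4), ContinuousOn
      (fun p : Fin (k + 1) → ℝ => polLimit F (k + 1) (fun K => ℰ1 k p K) ρ bV 0 1 z) (Box γ₀ k)) :
    EndpointExistence Cn ∧ ∃ γc : ℝ, 0 < γc ∧ BetaContH γc (betaOfTerms F ℰ0 ℰ1 ρ bV γ) := by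
  have hres : AtSlopeCont (oneLoopSplit_betaOfTerms F ℰ0 ℰ1 ρ bV γ) γ₀ (B12Normalization.stepBal Nc Lc) :=
    atSlopeCont_betaOfTerms F ℰ0 ℰ1 ρ bV hle A1 hrep hleaves hC h22 hq hs hsmall hcont
  exact ⟨endpointExistence_of_residue_atSlopeCont hgen (oneLoopSplit_betaOfTerms F ℰ0 ℰ1 ρ bV γ) Js (fun j => hβ j) h1 hγ₀
      hres, γ₀, hγ₀, betaContH_of_atSlopeCont hres⟩

end WallEnd

/-! ## §2 The sockets for EVERY split of the β of record (one-loop rigidity, dag-n28-a's `oneLoopSplit_unique`) -/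

section AnySplit

/-- `AtSlopeCont` does not depend on WHICH one-loop split is named: the printed split is unique (`N28AtBetaOfRecord.oneLoopSplit_unique`).
[cite: Balaban1987RG1, (2.12)–(2.14) p.268] -/
theorem atSlopeCont_congr_split {β : HBeta} (S S' : B12Beta.OneLoopSplit β) {γ₀ s : ℝ} (h : AtSlopeCont S' γ₀ s) :
    AtSlopeCont S γ₀ s := by
  rw [oneLoopSplit_unique S S']
  exact h

/-- **THE MERGED-DESIGN SOCKET FOR EVERY SPLIT**: for ANY `Sβ : OneLoopSplit (betaOfMerged (betaMerged F 𝓝 ρ bV) β⁰ γ)` (the split a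
NODE-O road, a (D1) road or gen 0's datum-level theorems quantify), the socket inputs of `atSlopeCont_betaOfMerged` give `AtSlopeCont Sβ γ₀ s`.
[cite: Balaban1987RG1, (1.20)-(1.22) p.264 and (2.12)-(2.14) p.268; Balaban1988RG2Cluster, Lemma 3 (2.38) p.20] -/
theorem atSlopeCont_anySplit_betaOfMerged (ℰ : TermFamily1 F 𝔄) (β0 : ℕ → ℝ)
    (Sβ : B12Beta.OneLoopSplit (betaOfMerged (betaMerged F ℰ ρ bV) β0 γ)) (hle : γ₀ ≤ γ) {s : ℝ} (P0 : ℕ → Pt 4 → ℝ)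
    (hβ0 : ∀ k, β0 k = B12Beta.secondMoment (fun _ _ => P0 k) 0 1)
    (hP0 : ∀ k, ∃ C δ₁ : ℝ, 0 < δ₁ ∧ B12Sec2to5.Decay510 (P0 k) C δ₁)
    (A1 : (k : ℕ) → (Fin (k + 1) → ℝ) → LDom 4 → Pt 4 → ℝ)
    (hrep : ∀ k (p : Fin (k + 1) → ℝ), p ∈ Box γ₀ k → ∀ z : Pt 4,
      polLimit F (k + 1) (fun K => ℰ k p K) ρ bV 0 1 z = P0 k z + limKernel (A1 k p) z)
    (hleaves : ∀ k (p : Fin (k + 1) → ℝ), p ∈ Box γ₀ k → PolLeavesTFac190H 4 M (A1 k p) c ℓ α₂ q)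
    (hC : CondsL 4 c ℓ) (h22 : c.R22gen ℓ) (hq : q.Valid c.δ₀) (hs : SignsL c α₂ q.B₃)
    (hsmall : c.ε₁ * remCoeffL 4 M c α₂ q.B₃ ≤ s)
    (hcont : ∀ k (z : Pt 4), ContinuousOn
      (fun p : Fin (k + 1) → ℝ => polLimit F (k + 1) (fun K => ℰ k p K) ρ bV 0 1 z) (Box γ₀ k)) :
    AtSlopeCont Sβ γ₀ s :=
  atSlopeCont_congr_split Sβ _ (atSlopeCont_betaOfMerged F ℰ ρ bV β0 hle P0 hβ0 hP0 A1 hrep hleaves hC h22 hq hs hsmall hcont)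

/-- **THE TWO-FAMILY SOCKET FOR EVERY SPLIT** of `betaOfTerms F ℰ⁰ ℰ¹ ρ bV γ`. [cite: Balaban1987RG1, (1.20)-(1.22) p.264 and (2.12)-(2.14) p.268] -/
theorem atSlopeCont_anySplit_betaOfTerms (ℰ0 : TermFamily0 F 𝔄) (ℰ1 : TermFamily1 F 𝔄)
    (Sβ : B12Beta.OneLoopSplit (betaOfTerms F ℰ0 ℰ1 ρ bV γ)) (hle : γ₀ ≤ γ) {s : ℝ}
    (A1 : (k : ℕ) → (Fin (k + 1) → ℝ) → LDom 4 → Pt 4 → ℝ)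
    (hrep : ∀ k (p : Fin (k + 1) → ℝ), p ∈ Box γ₀ k → ∀ z : Pt 4,
      polLimit F (k + 1) (fun K => ℰ1 k p K) ρ bV 0 1 z = limKernel (A1 k p) z)
    (hleaves : ∀ k (p : Fin (k + 1) → ℝ), p ∈ Box γ₀ k → PolLeavesTFac190H 4 M (A1 k p) c ℓ α₂ q)
    (hC : CondsL 4 c ℓ) (h22 : c.R22gen ℓ) (hq : q.Valid c.δ₀) (hs : SignsL c α₂ q.B₃)
    (hsmall : c.ε₁ * remCoeffL 4 M c α₂ q.B₃ ≤ s)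
    (hcont : ∀ k (z : Pt 4), ContinuousOn
      (fun p : Fin (k + 1) → ℝ => polLimit F (k + 1) (fun K => ℰ1 k p K) ρ bV 0 1 z) (Box γ₀ k)) :
    AtSlopeCont Sβ γ₀ s :=
  atSlopeCont_congr_split Sβ _ (atSlopeCont_betaOfTerms F ℰ0 ℰ1 ρ bV hle A1 hrep hleaves hC h22 hq hs hsmall hcont)

/-- Hence row (D1)'s pin `hβ : ∀ j, Sβ.β0 j = …` for ANY split of the merged β of record reads on the NAMED one-loop object `β⁰` (and
conversely) — `N28AtBetaOfRecord.oneLoopSplit_β0_eq`; recorded so that (D1)-side statements quantifying a split and the record's `β⁰` are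
interchangeable BY NAME. [cite: Balaban1987RG1, (2.12)–(2.14) p.268] -/
theorem d1pin_anySplit_iff (βm : HBeta) (β0 : ℕ → ℝ) (γ : ℝ) (Sβ : B12Beta.OneLoopSplit (betaOfMerged βm β0 γ))
    {Lc : ℕ} [NeZero Lc] (Js : ℕ → JetData 3 Lc) (μ ν : Fin 4) :
    (∀ j, Sβ.β0 j = B12Beta.secondMoment (TbalOf Lc Js j) μ ν) ↔
      ∀ j, β0 j = B12Beta.secondMoment (TbalOf Lc Js j) μ ν := by
  simp only [Summit.QuantumFields.YangMills.BalabanUVNodes.N28AtBetaOfRecord.oneLoopSplit_β0_eq]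

end AnySplit

end Summit.QuantumFields.YangMills.Theorems.BalabanUVNodesN26WallEnd

end
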